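import Literature.NumberTheory.Sieve.SmoothProfileModel
import HarnessLib

/-!
# `W`-class profile weights: decay, rescaling and the sublattice lemma for the model sums

Topic `Literature/NumberTheory/Sieve`, namespace `Literature.NumberTheory.Sieve.SmoothArcs`; the PROVED sequel of
`SmoothProfileModel` ([Harper2016, §5]).  With the notation of that file (`μ(n) = profileModelWeight c Mv X α n`,
`M(β) = profileModelSum c Mv X α β = Σ_ℓ c_ℓ · modelSum Mv X α (β + ℓ/X)`, `S₁ = Σ_ℓ ‖c_ℓ‖(1+|ℓ|)`,
`‖c‖_W = profileNorm c`):

* `profileModelSum_add_int`: `M(β + m) = M(β)` (`m ∈ ℤ`);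
* (M2) first-order decay by Abel summation (`norm_modelSum_mul_distInt_le` termwise; the terms `|ℓ| ≤ X|β|/2` keep
  `‖β + ℓ/X‖_{ℝ/ℤ} ≥ |β|/2`, the others are bounded trivially): `norm_modelSum_shift_le_div`,
  `norm_profileModelSum_le_div` (`‖M(β)‖ ≤ 5 Mv S₁/(X|β|)`, `0 < |β| ≤ 1/2`),
  `norm_profileModelSum_le_div_one_add` (`‖M(β)‖ ≤ 10 Mv S₁/(1 + X|β|)`, `|β| ≤ 1/2`) and
  `norm_profileModelSum_le_div_one_add_distInt` (`‖M(β)‖ ≤ 10 Mv S₁/(1 + X‖β‖_{ℝ/ℤ})`, all `β`);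
* (M3) the exact rescaling identities `profileModelWeight_rescale` (`μ_{X/t}(n) = t μ_X(tn)`),
  `profileModelWeight_const_mul`, `profileModelWeight_rescale_rpow` (`μ_{Mv t^{−α}, X/t}(n) = t·t^{−α} μ_{Mv,X}(tn)`),
  `profileModelSum_rescale` (`M_{X/t}(tβ) = t Σ_{n ≤ X, t ∣ n} μ_X(n) e(nβ)`), and the sublattice comparison
  `norm_profileModelSum_rescale_sub_le`, `norm_sublattice_sub_profileModelSum_le`:
  `‖t Σ_{n ≤ X, t ∣ n} μ(n) e(nβ) − M(β)‖ ≤ 24 Mv S₁ (1 + X|β|) t / X` (both sums are within (M1)-distance of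
  `Mv P̂_c(α; βX)`);
* the same bounds with `S₁ ≤ ‖c‖_W` under the `W`-norm hypothesis: `norm_profileModelSum_sub_le_profileNorm`,
  `norm_profileModelSum_le_profileNorm_div`, `norm_sublattice_sub_profileModelSum_le_profileNorm`.

## References

* A. J. Harper, Compositio Math. 152 (2016), §5 (smooth weights on the major arcs; model main terms) [Harper2016].
-/

noncomputable section

open Finset Real Complex MeasureTheory
open scoped FourierTransform

namespace Literature.NumberTheory.Sieve

namespace SmoothArcs

open TwistedWeight Endgame Vinogradov

variable {c : ℤ → ℂ}

/-! ### Periodicity -/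

/-- `M(β + m) = M(β)` for `m ∈ ℤ`. [folklore] -/
theorem profileModelSum_add_int (c : ℤ → ℂ) (Mv X α β : ℝ) (m : ℤ) :
    profileModelSum c Mv X α (β + m) = profileModelSum c Mv X α β := by
  unfold profileModelSum
  refine Finset.sum_congr rfl fun n _ => ?_
  congr 1
  have : (n : ℝ) * (β + m) = (n : ℝ) * β + ((n * m : ℤ) : ℝ) := by push_cast; ring
  rw [this, AddChar.map_add_eq_mul, Circle.coe_mul, RamanujanSum.fourierChar_intCast, mul_one]

/-! ### (M2) First-order decay in `β` -/

/-- The shifted single-bump model sum: for `x ≥ 1`, `0 ≤ α ≤ 1`, `0 < |β| ≤ 1/2` and any `l`,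
`‖modelSum M x α (β + l/x)‖ ≤ 5 M (1+|l|)/(x|β|)`
(if `|l| ≤ x|β|/2` then `‖β + l/x‖_{ℝ/ℤ} ≥ |β|/2` and Abel summation `norm_modelSum_mul_distInt_le` applies;
otherwise the trivial bound `M ≤ 2M(1+|l|)/(x|β|)`). [folklore] -/
theorem norm_modelSum_shift_le_div {M x α : ℝ} (hM : 0 ≤ M) (hx : 1 ≤ x) (hα : 0 ≤ α) (hα1 : α ≤ 1) {β : ℝ}
    (hβ0 : β ≠ 0) (hβ : |β| ≤ 1 / 2) (l : ℝ) :
    ‖modelSum M x α (β + l / x)‖ ≤ 5 * M * (1 + |l|) / (x * |β|) := by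
  have hx0 : 0 < x := by linarith
  have hβpos : 0 < |β| := abs_pos.mpr hβ0
  have hden : 0 < x * |β| := mul_pos hx0 hβpos
  rcases le_or_gt |l| (x * |β| / 2) with hin | hout
  · -- `‖θ‖_{ℝ/ℤ} ≥ |β|/2`
    set θ : ℝ := β + l / x with hθ
    have hlx : |l / x| ≤ |β| / 2 := by
      rw [abs_div, abs_of_pos hx0, div_le_iff₀ hx0]
      linarith
    have hθle : |θ| ≤ 3 / 4 := by
      have := abs_add_le β (l / x)
      linarith
    have hkey : |β| / 2 ≤ distInt θ := by
      show |β| / 2 ≤ |θ - round θ|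
      by_cases hr : round θ = 0
      · rw [hr, Int.cast_zero, sub_zero]
        have h1 : |β| ≤ |β + l / x| + |l / x| := by
          have := abs_add_le (β + l / x) (-(l / x))
          rwa [abs_neg, add_neg_cancel_right] at this
        linarith
      · have h1 : (1 : ℝ) ≤ |((round θ : ℤ) : ℝ)| := by
          rw [← Int.cast_abs]
          exact_mod_cast Int.one_le_abs hr
        have h2 := abs_sub_abs_le_abs_sub ((round θ : ℤ) : ℝ) θ
        rw [abs_sub_comm] at h2
        linarith
    have h := norm_modelSum_mul_distInt_le hM hx hα hα1 θ
    have h3 : ‖modelSum M x α θ‖ * |β| ≤ 5 * M / x := by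
      refine le_trans ?_ h
      exact mul_le_mul_of_nonneg_left (by linarith) (norm_nonneg _)
    calc ‖modelSum M x α θ‖ ≤ 5 * M / x / |β| := by rw [le_div_iff₀ hβpos]; exact h3
      _ = 5 * M * 1 / (x * |β|) := by field_simp
      _ ≤ 5 * M * (1 + |l|) / (x * |β|) := by
          gcongr
          linarith [abs_nonneg l]
  · -- trivial bound
    calc ‖modelSum M x α (β + l / x)‖ ≤ M := norm_modelSum_le hM hx0 hα _
      _ ≤ 5 * M * (1 + |l|) / (x * |β|) := by
          rw [le_div_iff₀ hden]
          nlinarith [mul_nonneg hM (abs_nonneg l), mul_nonneg hM hden.le]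

/-- **(M2) First-order decay**: for `X ≥ 1`, `0 ≤ α ≤ 1`, `Mv ≥ 0`, `0 < |β| ≤ 1/2`,
`‖M(β)‖ ≤ 5 Mv S₁/(X|β|)`. [cite: Harper2016, §5] -/
theorem norm_profileModelSum_le_div (hcW : Summable (fun ℓ : ℤ => ‖c ℓ‖ * (1 + |(ℓ : ℝ)|))) {Mv X α : ℝ}
    (hMv : 0 ≤ Mv) (hX : 1 ≤ X) (hα : 0 ≤ α) (hα1 : α ≤ 1) {β : ℝ} (hβ0 : β ≠ 0) (hβ : |β| ≤ 1 / 2) :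
    ‖profileModelSum c Mv X α β‖ ≤ 5 * Mv * (∑' ℓ : ℤ, ‖c ℓ‖ * (1 + |(ℓ : ℝ)|)) / (X * |β|) := by
  have hc' := summable_norm_of_mul hcW
  have hX0 : 0 < X := by linarith
  rw [profileModelSum_eq_tsum hc' hX0]
  refine (tsum_of_norm_bounded (hcW.hasSum.mul_left (5 * Mv / (X * |β|))) (fun ℓ => ?_)).trans
    (le_of_eq (by ring))
  rw [norm_mul]
  calc ‖c ℓ‖ * ‖modelSum Mv X α (β + ℓ / X)‖ ≤ ‖c ℓ‖ * (5 * Mv * (1 + |(ℓ : ℝ)|) / (X * |β|)) :=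
        mul_le_mul_of_nonneg_left (norm_modelSum_shift_le_div hMv hX hα hα1 hβ0 hβ ℓ) (norm_nonneg _)
    _ = 5 * Mv / (X * |β|) * (‖c ℓ‖ * (1 + |(ℓ : ℝ)|)) := by ring

/-- **(M2) combined with the trivial bound**: for `X ≥ 1`, `0 ≤ α ≤ 1`, `Mv ≥ 0`, `|β| ≤ 1/2`,
`‖M(β)‖ ≤ 10 Mv S₁/(1 + X|β|)`. [cite: Harper2016, §5] -/
theorem norm_profileModelSum_le_div_one_add (hcW : Summable (fun ℓ : ℤ => ‖c ℓ‖ * (1 + |(ℓ : ℝ)|)))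
    {Mv X α : ℝ} (hMv : 0 ≤ Mv) (hX : 1 ≤ X) (hα : 0 ≤ α) (hα1 : α ≤ 1) {β : ℝ} (hβ : |β| ≤ 1 / 2) :
    ‖profileModelSum c Mv X α β‖ ≤ 10 * Mv * (∑' ℓ : ℤ, ‖c ℓ‖ * (1 + |(ℓ : ℝ)|)) / (1 + X * |β|) := by
  have hc' := summable_norm_of_mul hcW
  have hX0 : 0 < X := by linarith
  set S₁ := ∑' ℓ : ℤ, ‖c ℓ‖ * (1 + |(ℓ : ℝ)|) with hS₁
  have hS : 0 ≤ S₁ := tsum_nonneg fun ℓ => by positivity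
  have hP : 0 ≤ Mv * S₁ := mul_nonneg hMv hS
  have hXβ : 0 ≤ X * |β| := by positivity
  rcases le_or_gt (X * |β|) 1 with hsmall | hbig
  · calc ‖profileModelSum c Mv X α β‖ ≤ Mv * ∑' ℓ : ℤ, ‖c ℓ‖ := norm_profileModelSum_le hc' hMv hX0 hα β
      _ ≤ Mv * S₁ := mul_le_mul_of_nonneg_left (tsum_norm_le_tsum_norm_mul hcW) hMv
      _ ≤ 10 * Mv * S₁ / (1 + X * |β|) := by
          rw [le_div_iff₀ (by positivity)]
          nlinarith
  · have hβ0 : β ≠ 0 := by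
      rintro rfl
      rw [abs_zero, mul_zero] at hbig
      linarith
    calc ‖profileModelSum c Mv X α β‖ ≤ 5 * Mv * S₁ / (X * |β|) := norm_profileModelSum_le_div hcW hMv hX hα hα1 hβ0 hβ
      _ ≤ 10 * Mv * S₁ / (1 + X * |β|) := by
          rw [div_le_div_iff₀ (by positivity) (by positivity)]
          nlinarith

/-- **(M2) for all `β`**, in terms of the distance `‖β‖_{ℝ/ℤ} = distInt β` to the nearest integer:
`‖M(β)‖ ≤ 10 Mv S₁/(1 + X‖β‖_{ℝ/ℤ})` (`X ≥ 1`, `0 ≤ α ≤ 1`, `Mv ≥ 0`; periodicity and the previous bound at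
`β − round β`). [cite: Harper2016, §5] -/
theorem norm_profileModelSum_le_div_one_add_distInt (hcW : Summable (fun ℓ : ℤ => ‖c ℓ‖ * (1 + |(ℓ : ℝ)|)))
    {Mv X α : ℝ} (hMv : 0 ≤ Mv) (hX : 1 ≤ X) (hα : 0 ≤ α) (hα1 : α ≤ 1) (β : ℝ) :
    ‖profileModelSum c Mv X α β‖ ≤ 10 * Mv * (∑' ℓ : ℤ, ‖c ℓ‖ * (1 + |(ℓ : ℝ)|)) / (1 + X * distInt β) := by
  have h := norm_profileModelSum_le_div_one_add hcW hMv hX hα hα1 (c := c) (β := β - round β) (abs_sub_round β)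
  have hper : profileModelSum c Mv X α (β - round β) = profileModelSum c Mv X α β := by
    have := profileModelSum_add_int c Mv X α β (-round β)
    rwa [Int.cast_neg, ← sub_eq_add_neg] at this
  rw [hper] at h
  exact h

/-! ### (M3) Rescaling and the sublattice of multiples of `t` -/

/-- **Exact rescaling of the weights**: `μ_{Mv, X/t}(n) = t · μ_{Mv, X}(tn)` (`n/(X/t) = tn/X`). [folklore] -/
theorem profileModelWeight_rescale (c : ℤ → ℂ) (Mv X α : ℝ) (t n : ℕ) :
    profileModelWeight c Mv (X / t) α n = (t : ℂ) * profileModelWeight c Mv X α (t * n) := by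
  unfold profileModelWeight
  have h1 : (n : ℝ) / (X / t) = ((t * n : ℕ) : ℝ) / X := by
    rw [div_div_eq_mul_div, Nat.cast_mul]; ring
  have h2 : Mv / (X / t) = (t : ℝ) * (Mv / X) := by
    rw [div_div_eq_mul_div]; ring
  rw [h1, h2]
  push_cast
  ring

/-- The weights are linear in `Mv`. [folklore] -/
theorem profileModelWeight_const_mul (c : ℤ → ℂ) (a Mv X α : ℝ) (n : ℕ) :
    profileModelWeight c (a * Mv) X α n = (a : ℂ) * profileModelWeight c Mv X α n := by
  unfold profileModelWeight
  push_cast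
  ring

/-- **Exact rescaling, with the factor `t^{−α}`** (the form met when a variable lives on `t ℕ`):
`μ_{Mv t^{−α}, X/t}(n) = t · t^{−α} · μ_{Mv, X}(tn)`. [folklore] -/
theorem profileModelWeight_rescale_rpow (c : ℤ → ℂ) (Mv X α : ℝ) (t n : ℕ) :
    profileModelWeight c (Mv * (t : ℝ) ^ (-α)) (X / t) α n =
      (t : ℂ) * ((((t : ℝ) ^ (-α) : ℝ)) : ℂ) * profileModelWeight c Mv X α (t * n) := by
  rw [mul_comm Mv, profileModelWeight_const_mul, profileModelWeight_rescale]
  ring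

/-- **Exact rescaling of the model sum**: `M_{Mv, X/t}(tβ) = t Σ_{n ≤ X, t ∣ n} μ_{Mv, X}(n) e(nβ)` (`t ≥ 1`;
reindex the multiples of `t` in `[1, ⌊X⌋]` as `tm`, `1 ≤ m ≤ ⌊X⌋/t = ⌊X/t⌋`). [folklore] -/
theorem profileModelSum_rescale (c : ℤ → ℂ) (Mv X α β : ℝ) {t : ℕ} (ht : 0 < t) :
    profileModelSum c Mv (X / t) α (t * β) =
      (t : ℂ) * ∑ n ∈ (Icc 1 ⌊X⌋₊).filter (t ∣ ·), profileModelWeight c Mv X α n * (𝐞 ((n : ℝ) * β) : ℂ) := by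
  -- the reindexing (cf. `FriedlanderIwaniecPrimes.sum_filter_dvd_Icc`, not imported to keep the import closure small)
  have hre : ∑ n ∈ (Icc 1 ⌊X⌋₊).filter (t ∣ ·), profileModelWeight c Mv X α n * (𝐞 ((n : ℝ) * β) : ℂ) =
      ∑ m ∈ Icc 1 (⌊X⌋₊ / t), profileModelWeight c Mv X α (t * m) * (𝐞 (((t * m : ℕ) : ℝ) * β) : ℂ) := by
    symm
    refine Finset.sum_nbij' (fun m => t * m) (fun n => n / t) ?_ ?_ ?_ ?_ ?_
    · intro m hm
      obtain ⟨h1, h2⟩ := Finset.mem_Icc.mp (Finset.mem_coe.mp hm)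
      rw [Nat.le_div_iff_mul_le ht] at h2
      refine Finset.mem_coe.mpr (Finset.mem_filter.mpr ⟨Finset.mem_Icc.mpr ⟨?_, ?_⟩, dvd_mul_right t m⟩)
      · exact le_trans h1 (Nat.le_mul_of_pos_left m ht)
      · rwa [mul_comm]
    · intro n hn
      obtain ⟨hn', hdvd⟩ := Finset.mem_filter.mp (Finset.mem_coe.mp hn)
      obtain ⟨h1, h2⟩ := Finset.mem_Icc.mp hn'
      exact Finset.mem_coe.mpr (Finset.mem_Icc.mpr ⟨Nat.div_pos (Nat.le_of_dvd h1 hdvd) ht, Nat.div_le_div_right h2⟩)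
    · intro m _
      exact Nat.mul_div_cancel_left m ht
    · intro n hn
      obtain ⟨_, hdvd⟩ := Finset.mem_filter.mp (Finset.mem_coe.mp hn)
      exact Nat.mul_div_cancel' hdvd
    · intro m _
      rfl
  rw [hre, profileModelSum, Nat.floor_div_natCast, Finset.mul_sum]
  refine Finset.sum_congr rfl fun m _ => ?_
  rw [profileModelWeight_rescale, Nat.cast_mul, show (m : ℝ) * ((t : ℝ) * β) = (t : ℝ) * (m : ℝ) * β by ring]
  ring

/-- **(M3) Rescaled sum versus the full sum**: for `X ≥ 1`, `0 ≤ α ≤ 1`, `Mv ≥ 0`, `t ≥ 1`,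
`‖M_{X/t}(tβ) − M_X(β)‖ ≤ 24 Mv S₁ (1 + X|β|) t / X`
(both are within `12 Mv (1+X|β|) S₁ t/X` of `Mv P̂_c(α; βX)` by (M1) when `t ≤ X`; when `t > X` the rescaled sum
is empty and the trivial bound applies). [cite: Harper2016, §5] -/
theorem norm_profileModelSum_rescale_sub_le (hcW : Summable (fun ℓ : ℤ => ‖c ℓ‖ * (1 + |(ℓ : ℝ)|))) {Mv X α : ℝ}
    (hMv : 0 ≤ Mv) (hX : 1 ≤ X) (hα : 0 ≤ α) (hα1 : α ≤ 1) (β : ℝ) {t : ℕ} (ht : 0 < t) :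
    ‖profileModelSum c Mv (X / t) α (t * β) - profileModelSum c Mv X α β‖ ≤
      24 * Mv * (∑' ℓ : ℤ, ‖c ℓ‖ * (1 + |(ℓ : ℝ)|)) * (1 + X * |β|) * t / X := by
  have hc' := summable_norm_of_mul hcW
  set S₁ := ∑' ℓ : ℤ, ‖c ℓ‖ * (1 + |(ℓ : ℝ)|) with hS₁
  have hS : 0 ≤ S₁ := tsum_nonneg fun ℓ => by positivity
  have hX0 : 0 < X := by linarith
  have ht0 : (0 : ℝ) < t := by exact_mod_cast ht
  have ht1 : (1 : ℝ) ≤ t := by exact_mod_cast ht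
  have hβX : |β * X| = X * |β| := by rw [abs_mul, abs_of_pos hX0, mul_comm]
  have hP : 0 ≤ Mv * S₁ * (1 + X * |β|) := by positivity
  rcases le_or_gt (t : ℝ) X with htX | htX
  · have hXt : 1 ≤ X / t := by rwa [le_div_iff₀ ht0, one_mul]
    have h1 := norm_profileModelSum_sub_le hcW hMv hXt hα hα1 (t * β)
    have h2 := norm_profileModelSum_sub_le hcW hMv hX hα hα1 β
    rw [show (t : ℝ) * β * (X / t) = β * X by field_simp] at h1
    rw [hβX] at h1 h2
    calc ‖profileModelSum c Mv (X / t) α (t * β) - profileModelSum c Mv X α β‖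
        = ‖(profileModelSum c Mv (X / t) α (t * β) - (Mv : ℂ) * profileMellin c α (β * X)) -
            (profileModelSum c Mv X α β - (Mv : ℂ) * profileMellin c α (β * X))‖ := by
          rw [sub_sub_sub_cancel_right]
      _ ≤ 12 * Mv * (1 + X * |β|) * S₁ / (X / t) + 12 * Mv * (1 + X * |β|) * S₁ / X :=
          (norm_sub_le _ _).trans (add_le_add h1 h2)
      _ = 12 * (Mv * S₁ * (1 + X * |β|)) * (t + 1) / X := by
          field_simp
      _ ≤ 24 * Mv * S₁ * (1 + X * |β|) * t / X := by
          refine div_le_div_of_nonneg_right ?_ hX0.le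
          nlinarith [mul_nonneg hP (sub_nonneg.mpr ht1)]
  · have h0 : ⌊X / t⌋₊ = 0 := Nat.floor_eq_zero.mpr ((div_lt_one ht0).mpr htX)
    have hempty : profileModelSum c Mv (X / t) α (t * β) = 0 := by
      rw [profileModelSum, h0]
      simp
    rw [hempty, zero_sub, norm_neg]
    calc ‖profileModelSum c Mv X α β‖ ≤ Mv * ∑' ℓ : ℤ, ‖c ℓ‖ := norm_profileModelSum_le hc' hMv hX0 hα β
      _ ≤ Mv * S₁ := mul_le_mul_of_nonneg_left (tsum_norm_le_tsum_norm_mul hcW) hMv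
      _ ≤ 24 * Mv * S₁ * (1 + X * |β|) * t / X := by
          rw [le_div_iff₀ hX0]
          calc Mv * S₁ * X ≤ Mv * S₁ * t := mul_le_mul_of_nonneg_left htX.le (mul_nonneg hMv hS)
            _ ≤ Mv * S₁ * t * (1 + X * |β|) :=
                le_mul_of_one_le_right (by positivity) (by nlinarith [abs_nonneg β, hX0.le])
            _ ≤ Mv * S₁ * t * (1 + X * |β|) * 24 := le_mul_of_one_le_right (by positivity) (by norm_num)
            _ = 24 * Mv * S₁ * (1 + X * |β|) * t := by ring

/-- **(M3) The sublattice of multiples of `t`**: for `X ≥ 1`, `0 ≤ α ≤ 1`, `Mv ≥ 0`, `t ≥ 1`,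
`‖t Σ_{n ≤ X, t ∣ n} μ(n) e(nβ) − M(β)‖ ≤ 24 Mv S₁ (1 + X|β|) t / X`. [cite: Harper2016, §5] -/
theorem norm_sublattice_sub_profileModelSum_le (hcW : Summable (fun ℓ : ℤ => ‖c ℓ‖ * (1 + |(ℓ : ℝ)|)))
    {Mv X α : ℝ} (hMv : 0 ≤ Mv) (hX : 1 ≤ X) (hα : 0 ≤ α) (hα1 : α ≤ 1) (β : ℝ) {t : ℕ} (ht : 0 < t) :
    ‖(t : ℂ) * (∑ n ∈ (Icc 1 ⌊X⌋₊).filter (t ∣ ·), profileModelWeight c Mv X α n * (𝐞 ((n : ℝ) * β) : ℂ)) -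
        profileModelSum c Mv X α β‖ ≤
      24 * Mv * (∑' ℓ : ℤ, ‖c ℓ‖ * (1 + |(ℓ : ℝ)|)) * (1 + X * |β|) * t / X := by
  rw [← profileModelSum_rescale c Mv X α β ht]
  exact norm_profileModelSum_rescale_sub_le hcW hMv hX hα hα1 β ht

/-! ### The bounds under the `W`-norm hypothesis (`S₁ ≤ ‖c‖_W`) -/

/-- (M1) with `‖c‖_W`: `‖M(β) − Mv P̂_c(α; βX)‖ ≤ 12 Mv (1+|βX|) ‖c‖_W / X`. [cite: Harper2016, §5] -/
theorem norm_profileModelSum_sub_le_profileNorm (hc : Summable (fun ℓ : ℤ => ‖c ℓ‖ * (1 + |(ℓ : ℝ)|) ^ 3))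
    {Mv X α : ℝ} (hMv : 0 ≤ Mv) (hX : 1 ≤ X) (hα : 0 ≤ α) (hα1 : α ≤ 1) (β : ℝ) :
    ‖profileModelSum c Mv X α β - (Mv : ℂ) * profileMellin c α (β * X)‖ ≤
      12 * Mv * (1 + |β * X|) * profileNorm c / X := by
  refine (norm_profileModelSum_sub_le (summable_norm_mul_of_cube hc) hMv hX hα hα1 β).trans ?_
  have hX0 : 0 < X := by linarith
  exact div_le_div_of_nonneg_right
    (mul_le_mul_of_nonneg_left (tsum_norm_mul_le_profileNorm hc) (by positivity)) hX0.le

/-- (M2) with `‖c‖_W`: `‖M(β)‖ ≤ 10 Mv ‖c‖_W/(1 + X‖β‖_{ℝ/ℤ})` for all `β`. [cite: Harper2016, §5] -/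
theorem norm_profileModelSum_le_profileNorm_div (hc : Summable (fun ℓ : ℤ => ‖c ℓ‖ * (1 + |(ℓ : ℝ)|) ^ 3))
    {Mv X α : ℝ} (hMv : 0 ≤ Mv) (hX : 1 ≤ X) (hα : 0 ≤ α) (hα1 : α ≤ 1) (β : ℝ) :
    ‖profileModelSum c Mv X α β‖ ≤ 10 * Mv * profileNorm c / (1 + X * distInt β) := by
  refine (norm_profileModelSum_le_div_one_add_distInt (summable_norm_mul_of_cube hc) hMv hX hα hα1 β).trans ?_
  have hX0 : 0 < X := by linarith
  have hd : 0 < 1 + X * distInt β := by have := distInt_nonneg β; positivity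
  exact div_le_div_of_nonneg_right
    (mul_le_mul_of_nonneg_left (tsum_norm_mul_le_profileNorm hc) (by positivity)) hd.le

/-- (M3) with `‖c‖_W`: `‖t Σ_{n ≤ X, t ∣ n} μ(n) e(nβ) − M(β)‖ ≤ 24 Mv ‖c‖_W (1 + X|β|) t / X`.
[cite: Harper2016, §5] -/
theorem norm_sublattice_sub_profileModelSum_le_profileNorm
    (hc : Summable (fun ℓ : ℤ => ‖c ℓ‖ * (1 + |(ℓ : ℝ)|) ^ 3)) {Mv X α : ℝ} (hMv : 0 ≤ Mv) (hX : 1 ≤ X)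
    (hα : 0 ≤ α) (hα1 : α ≤ 1) (β : ℝ) {t : ℕ} (ht : 0 < t) :
    ‖(t : ℂ) * (∑ n ∈ (Icc 1 ⌊X⌋₊).filter (t ∣ ·), profileModelWeight c Mv X α n * (𝐞 ((n : ℝ) * β) : ℂ)) -
        profileModelSum c Mv X α β‖ ≤ 24 * Mv * profileNorm c * (1 + X * |β|) * t / X := by
  refine (norm_sublattice_sub_profileModelSum_le (summable_norm_mul_of_cube hc) hMv hX hα hα1 β ht).trans ?_
  have hX0 : 0 < X := by linarith
  refine div_le_div_of_nonneg_right ?_ hX0.le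
  have h := tsum_norm_mul_le_profileNorm hc
  have h1 : 0 ≤ 24 * Mv * (1 + X * |β|) * t := by positivity
  nlinarith [mul_le_mul_of_nonneg_left h h1]

end SmoothArcs

end Literature.NumberTheory.Sieve

end
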